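import Mathlib
import Summits.Ventures.PercRepro2.Independence
import Summits.Ventures.PercRepro2.Harris
import Summits.Ventures.PercRepro2.HCov
import Summits.Ventures.PercRepro2.CutVertexPaths
import Summits.Ventures.PercRepro2.CutOneFarConn
import Summits.Ventures.PercRepro2.CutTwoFarConn

/-!
# Two marks behind a cut vertex, II: THE LAW OF THE PART (blind cell PercRepro2, typer-1 g50)

The law of the configuration map `Ψ` of `CutTwoFarConn.lean`.  The LAW OF THE PART is
`patProb p τ = P_p(pat = τ)` — the law of the connection pattern of `{v, w₁, w₂}` inside the left
part — and the GADGET WEIGHTS of a pattern `τ` are the right weights with weight `τ i ∈ {0, 1}` on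
the gadget edges (`gweights`).  The fibre of `Ψ` over a gadget configuration `σ'` is the right
cylinder intersected with the pattern event (`fibre_eq`), two events on disjoint edge sets, so its
probability is (right product) × (law of the part at the pattern of `σ'`) (`prob_fibre_eq`); summing
over the fibres,

  `P_p(Ψ⁻¹ A) = ∑_τ patProb p τ · P_{gweights τ}(A)`   (**`prob_Ψ_preimage`**)

for every gadget event `A`: the law of `Ψ` is the `patProb`-MIXTURE of the (at most five realisable)
deterministic-gadget laws.  Own work; standard axioms.
-/

namespace Summit.Ventures.PercRepro2

open CovForm CutVertexM9

namespace CutTwoFar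

/-! ## The law of `Ψ`: a mixture of the gadget laws, weighted by the law of the part -/

section Law

variable {V : Type*} {E : Type*} [Fintype E] [DecidableEq E] {R : Type*} [Field R]
variable (ends : E → Sym2 V) (side : E → Bool) (v w₁ w₂ : V)

/-- **The law of the part**: the probability that the left pattern of `{v, w₁, w₂}` is `τ`. -/
noncomputable def patProb (p : E → R) (τ : Fin 3 → Bool) : R :=
  prob p {ω | pat ends side v w₁ w₂ ω = τ}

omit [Fintype E] [DecidableEq E] in
/-- The pattern is transitive: two of the three pairs joined force the third. -/
lemma pat_transitive (ω : Config E) :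
    ¬ (pat ends side v w₁ w₂ ω 0 = true ∧ pat ends side v w₁ w₂ ω 1 = true ∧
        pat ends side v w₁ w₂ ω 2 = false) ∧
      ¬ (pat ends side v w₁ w₂ ω 0 = true ∧ pat ends side v w₁ w₂ ω 2 = true ∧
        pat ends side v w₁ w₂ ω 1 = false) ∧
      ¬ (pat ends side v w₁ w₂ ω 1 = true ∧ pat ends side v w₁ w₂ ω 2 = true ∧
        pat ends side v w₁ w₂ ω 0 = false) := by
  refine ⟨fun ⟨h0, h1, h2⟩ => ?_, fun ⟨h0, h2, h1⟩ => ?_, fun ⟨h1, h2, h0⟩ => ?_⟩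
  · rw [pat_zero_iff] at h0
    rw [pat_one_iff] at h1
    rw [← Bool.not_eq_true, pat_two_iff] at h2
    exact h2 (conn_trans h0 (conn_symm h1))
  · rw [pat_zero_iff] at h0
    rw [pat_two_iff] at h2
    rw [← Bool.not_eq_true, pat_one_iff] at h1
    exact h1 (conn_trans (conn_symm h2) h0)
  · rw [pat_one_iff] at h1
    rw [pat_two_iff] at h2
    rw [← Bool.not_eq_true, pat_zero_iff] at h0
    exact h0 (conn_trans h2 h1)

/-- **The law of the part is carried by the five transitive patterns**: a pattern with two pairs
joined and the third not has probability `0`. -/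
lemma patProb_eq_zero_of_nontransitive (p : E → R) {τ : Fin 3 → Bool}
    (hτ : (τ 0 = true ∧ τ 1 = true ∧ τ 2 = false) ∨ (τ 0 = true ∧ τ 2 = true ∧ τ 1 = false) ∨
      (τ 1 = true ∧ τ 2 = true ∧ τ 0 = false)) :
    patProb ends side v w₁ w₂ p τ = 0 := by
  have hempty : {ω : Config E | pat ends side v w₁ w₂ ω = τ} = ∅ := by
    ext ω
    simp only [Set.mem_setOf_eq, Set.mem_empty_iff_false, iff_false]
    rintro rfl
    obtain ⟨n1, n2, n3⟩ := pat_transitive ends side v w₁ w₂ ω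
    rcases hτ with h | h | h
    · exact n1 h
    · exact n2 h
    · exact n3 h
  rw [patProb, hempty, prob_empty]

/-- The gadget weights of a pattern `τ`: the right weights, and weight `1` (open) or `0` (closed)
on each gadget edge according to `τ`. -/
def gweights (p : E → R) (τ : Fin 3 → Bool) : GEdge side → R
  | Sum.inl e => p e.1
  | Sum.inr i => if τ i then 1 else 0

omit [Fintype E] [DecidableEq E] in
/-- The gadget weights are admissible when `p` is. -/
lemma isProbVec_gweights [LinearOrder R] [IsStrictOrderedRing R] {p : E → R} (hp : IsProbVec p)
    (τ : Fin 3 → Bool) : IsProbVec (gweights side p τ) where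
  nonneg := by
    rintro (e | i)
    · exact hp.nonneg e.1
    · show (0 : R) ≤ if τ i then 1 else 0
      split_ifs <;> simp
  le_one := by
    rintro (e | i)
    · exact hp.le_one e.1
    · show (if τ i then (1 : R) else 0) ≤ 1
      split_ifs <;> simp

omit [Fintype E] [DecidableEq E] in
/-- The gadget weights only read the right weights. -/
lemma gweights_eq_of_agree {p p' : E → R} (hR : ∀ e, side e = false → p e = p' e)
    (τ : Fin 3 → Bool) : gweights side p τ = gweights side p' τ := by
  funext e
  rcases e with e | i
  · exact hR e.1 e.2
  · rfl

/-- The right cylinder of a gadget configuration: the right edges in the states of `σ'`. -/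
def rightCyl (σ' : Config (GEdge side)) : Set (Config E) :=
  {ω | ∀ e : {e : E // side e = false}, ω e.1 = σ' (Sum.inl e)}

/-- The pattern event of a gadget configuration: the left pattern is the one `σ'` prescribes on
the gadget edges. -/
def patEvt (σ' : Config (GEdge side)) : Set (Config E) :=
  {ω | pat ends side v w₁ w₂ ω = fun i => σ' (Sum.inr i)}

omit [Fintype E] [DecidableEq E] in
/-- The fibre of `Ψ` is the right cylinder intersected with the pattern event. -/
lemma fibre_eq (σ' : Config (GEdge side)) :
    {ω : Config E | Ψ ends side v w₁ w₂ ω = σ'} = rightCyl side σ' ∩ patEvt ends side v w₁ w₂ σ' := by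
  ext ω
  simp only [Set.mem_setOf_eq, Set.mem_inter_iff, rightCyl, patEvt]
  constructor
  · intro h
    exact ⟨fun e => by rw [← h]; rfl, by funext i; rw [← h]; rfl⟩
  · rintro ⟨h1, h2⟩
    funext e'
    rcases e' with e | i
    · exact h1 e
    · exact congrFun h2 i

omit [Fintype E] [DecidableEq E] in
/-- The right cylinder is determined by the right edges. -/
lemma dependsOn_rightCyl (σ' : Config (GEdge side)) :
    DependsOn (· ∈ rightCyl side σ') {e | side e = false} := by
  intro ω ω' h
  simp only [rightCyl, Set.mem_setOf_eq]
  exact propext ⟨fun hω e => by rw [← h e.1 e.2]; exact hω e,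
    fun hω e => by rw [h e.1 e.2]; exact hω e⟩

omit [Fintype E] [DecidableEq E] in
/-- The pattern event is determined by the left edges. -/
lemma dependsOn_patEvt (σ' : Config (GEdge side)) :
    DependsOn (· ∈ patEvt ends side v w₁ w₂ σ') {e | side e = true} := by
  intro ω ω' h
  simp only [patEvt, Set.mem_setOf_eq]
  rw [pat_eq_of_agree ends side v w₁ w₂ h]

/-- The right product: the Bernoulli factors of the right edges. -/
def rightProd (p : E → R) (σ' : Config (GEdge side)) : R :=
  ∏ e : {e : E // side e = false}, edgeFactor (p e.1) (σ' (Sum.inl e))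

/-- The probability of the right cylinder is the right product. -/
lemma prob_rightCyl (p : E → R) (σ' : Config (GEdge side)) :
    prob p (rightCyl side σ') = rightProd side p σ' := by
  classical
  let σR : Config E := fun e => if h : side e = false then σ' (Sum.inl ⟨e, h⟩) else false
  have hcyl : rightCyl side σ' = cylinder (Finset.univ.filter fun e => side e = false) σR := by
    ext ω
    simp only [rightCyl, Set.mem_setOf_eq, mem_cylinder, Finset.mem_filter, Finset.mem_univ,
      true_and, σR]
    constructor
    · intro h e he
      rw [dif_pos he]
      exact h ⟨e, he⟩
    · intro h e
      have := h e.1 e.2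
      rwa [dif_pos e.2] at this
  rw [hcyl, prob_cylinder, rightProd, Finset.prod_subtype (p := fun e => side e = false)
    (Finset.univ.filter fun e => side e = false) (fun e => by simp)]
  refine Finset.prod_congr rfl fun e _ => ?_
  simp only [σR, dif_pos e.2]

/-- The probability of the pattern event is the law of the part at the prescribed pattern. -/
lemma prob_patEvt (p : E → R) (σ' : Config (GEdge side)) :
    prob p (patEvt ends side v w₁ w₂ σ') = patProb ends side v w₁ w₂ p fun i => σ' (Sum.inr i) :=
  rfl

/-- **The law of `Ψ` at a point**: the fibre of `σ'` has probability (right product) × (law of the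
part at the pattern of `σ'`). -/
theorem prob_fibre_eq (p : E → R) (σ' : Config (GEdge side)) :
    prob p {ω | Ψ ends side v w₁ w₂ ω = σ'} =
      rightProd side p σ' * patProb ends side v w₁ w₂ p fun i => σ' (Sum.inr i) := by
  have hdisj : Disjoint {e | side e = false} {e | side e = true} := by
    rw [Set.disjoint_left]
    intro e he he'
    simp only [Set.mem_setOf_eq] at he he'
    rw [he] at he'
    exact Bool.false_ne_true he'
  rw [fibre_eq, prob_inter_eq_mul_of_dependsOn p hdisj (dependsOn_rightCyl side σ')
    (dependsOn_patEvt ends side v w₁ w₂ σ'), prob_rightCyl, prob_patEvt]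

omit [Fintype E] [DecidableEq E] in
/-- A `{0, 1}`-weighted edge has factor `1` in its prescribed state and `0` otherwise. -/
lemma edgeFactor_ite (t b : Bool) :
    edgeFactor (if t then (1 : R) else 0) b = if b = t then 1 else 0 := by
  cases t <;> cases b <;> simp [edgeFactor]

omit [DecidableEq E] in
/-- The weight of a gadget configuration at the gadget weights of `τ`: the right product if its
gadget edges are in the states `τ`, and `0` otherwise. -/
lemma weight_gweights (p : E → R) (τ : Fin 3 → Bool) (σ' : Config (GEdge side)) :
    weight (gweights side p τ) σ' =
      rightProd side p σ' * if (fun i => σ' (Sum.inr i)) = τ then 1 else 0 := by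
  rw [weight, Fintype.prod_sum_type, rightProd]
  congr 1
  have : ∀ i : Fin 3, edgeFactor (gweights side p τ (Sum.inr i)) (σ' (Sum.inr i)) =
      if σ' (Sum.inr i) = τ i then 1 else 0 := fun i => edgeFactor_ite (τ i) _
  simp only [this, Finset.prod_boole, Finset.mem_univ, true_implies]
  congr 1
  exact propext ⟨fun h => funext h, fun h i => congrFun h i⟩

/-- **The law of `Ψ` is the mixture of the gadget laws**: the probability of a gadget event under
`Ψ` is the `patProb`-mixture of its probabilities at the gadget weights of the patterns. -/
theorem prob_Ψ_preimage (p : E → R) (A : Set (Config (GEdge side))) :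
    prob p (Ψ ends side v w₁ w₂ ⁻¹' A) =
      ∑ τ : Fin 3 → Bool, patProb ends side v w₁ w₂ p τ * prob (gweights side p τ) A := by
  classical
  have hL : prob p (Ψ ends side v w₁ w₂ ⁻¹' A) =
      ∑ σ', A.indicator (fun σ' => prob p {ω | Ψ ends side v w₁ w₂ ω = σ'}) σ' := by
    calc prob p (Ψ ends side v w₁ w₂ ⁻¹' A)
        = ∑ ω, (Ψ ends side v w₁ w₂ ⁻¹' A).indicator (weight p) ω := rfl
      _ = ∑ σ', ∑ ω ∈ Finset.univ.filter (fun ω => Ψ ends side v w₁ w₂ ω = σ'),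
            (Ψ ends side v w₁ w₂ ⁻¹' A).indicator (weight p) ω :=
          (Finset.sum_fiberwise Finset.univ (Ψ ends side v w₁ w₂) _).symm
      _ = ∑ σ', A.indicator (fun σ' => prob p {ω | Ψ ends side v w₁ w₂ ω = σ'}) σ' := by
          refine Finset.sum_congr rfl fun σ' _ => ?_
          by_cases hA : σ' ∈ A
          · rw [Set.indicator_of_mem hA]
            unfold prob
            rw [Finset.sum_filter]
            refine Finset.sum_congr rfl fun ω _ => ?_
            by_cases hω : Ψ ends side v w₁ w₂ ω = σ'
            · rw [if_pos hω,
                Set.indicator_of_mem (show ω ∈ {ω | Ψ ends side v w₁ w₂ ω = σ'} from hω),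
                Set.indicator_of_mem (show ω ∈ Ψ ends side v w₁ w₂ ⁻¹' A from by
                  rw [Set.mem_preimage, hω]; exact hA)]
            · rw [if_neg hω,
                Set.indicator_of_notMem (show ω ∉ {ω | Ψ ends side v w₁ w₂ ω = σ'} from hω)]
          · rw [Set.indicator_of_notMem hA]
            refine Finset.sum_eq_zero fun ω hω => ?_
            rw [Finset.mem_filter] at hω
            rw [Set.indicator_of_notMem]
            rw [Set.mem_preimage, hω.2]
            exact hA
  have hR : ∀ τ : Fin 3 → Bool, prob (gweights side p τ) A =
      ∑ σ', A.indicator (fun σ' => rightProd side p σ' *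
        if (fun i => σ' (Sum.inr i)) = τ then 1 else 0) σ' := by
    intro τ
    unfold prob
    refine Finset.sum_congr rfl fun σ' _ => ?_
    by_cases hA : σ' ∈ A
    · rw [Set.indicator_of_mem hA, Set.indicator_of_mem hA, weight_gweights]
    · rw [Set.indicator_of_notMem hA, Set.indicator_of_notMem hA]
  rw [hL]
  simp_rw [hR, Finset.mul_sum]
  rw [Finset.sum_comm]
  refine Finset.sum_congr rfl fun σ' _ => ?_
  by_cases hA : σ' ∈ A
  · simp only [Set.indicator_of_mem hA, prob_fibre_eq, mul_ite, mul_one, mul_zero,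
      Finset.sum_ite_eq, Finset.mem_univ, if_true]
    ring
  · simp only [Set.indicator_of_notMem hA, mul_zero, Finset.sum_const_zero]

/-- The right edge type. -/
abbrev REdges (side : E → Bool) : Type _ := {e : E // side e = false}

/-- The right weights. -/
def rweights (p : E → R) : REdges side → R := fun e => p e.1

/-- A gadget configuration from a right configuration and a pattern. -/
def glue (σ : Config (REdges side)) (τ : Fin 3 → Bool) : Config (GEdge side) := Sum.elim σ τ

omit [DecidableEq E] in
/-- The right product of a glued configuration is the right weight of its right part. -/
lemma rightProd_glue (p : E → R) (σ : Config (REdges side)) (τ : Fin 3 → Bool) :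
    rightProd side p (glue side σ τ) = weight (rweights side p) σ := rfl

/-- **A gadget probability is a right-side probability**: at the gadget weights of `τ` the gadget
edges are pinned to `τ`, so the probability of a gadget event is the right-weight probability of
its section at `τ`. -/
theorem prob_gweights_eq_section (p : E → R) (τ : Fin 3 → Bool) (A : Set (Config (GEdge side))) :
    prob (gweights side p τ) A = prob (rweights side p) {σ | glue side σ τ ∈ A} := by
  classical
  unfold prob
  rw [← (Equiv.sumArrowEquivProdArrow (REdges side) (Fin 3) Bool).symm.sum_comp,
    Fintype.sum_prod_type]
  refine Finset.sum_congr rfl fun σ _ => ?_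
  show ∑ ρ : Fin 3 → Bool, A.indicator (weight (gweights side p τ)) (glue side σ ρ) = _
  have hw : ∀ ρ : Fin 3 → Bool, weight (gweights side p τ) (glue side σ ρ) =
      weight (rweights side p) σ * if ρ = τ then 1 else 0 := by
    intro ρ
    rw [weight_gweights, ← rightProd_glue side p σ ρ]
    rfl
  rw [Finset.sum_eq_single τ]
  · by_cases hA : glue side σ τ ∈ A
    · rw [Set.indicator_of_mem hA, Set.indicator_of_mem (show σ ∈ {σ | glue side σ τ ∈ A} from hA),
        hw, if_pos rfl, mul_one]
    · rw [Set.indicator_of_notMem hA,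
        Set.indicator_of_notMem (show σ ∉ {σ | glue side σ τ ∈ A} from hA)]
  · intro ρ _ hρ
    rw [Set.indicator_apply_eq_zero]
    intro _
    rw [hw, if_neg hρ, mul_zero]
  · intro h
    exact absurd (Finset.mem_univ τ) h

end Law

end CutTwoFar

end Summit.Ventures.PercRepro2
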